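import Literature.AlgebraicGeometry.Resolution.HypersurfaceRestriction
import Literature.AlgebraicGeometry.Resolution.CartierDivisorControlledTransform
import Literature.AlgebraicGeometry.Resolution.ControlledTransformBaseChange
import HarnessLib
import HarnessLib.Audit.Tags

/-!
# Purely inseparable dim 4 — (M-c): the controlled transform with the ORDER as weight cuts out the BLOW-UP of the hypersurface

E2(3,3) dictionary of cell `res-dim4-pi` (desk WORD #59 (a), sub-row (M-c) of the transfer row `ModelRow` /
`LocalizationRow`, holder p-2 g2): along the tower of point blow-ups of the ambient (p-2 g2's (M-a) `globalModel`), the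
hypersurface `X_i = V((M i).ideal)` is carried by the CONTROLLED transform with weight `M.mult = 3 = ord_{x_i}`; this file
proves that `V(τᶜ(𝓗, m)) ⟶ V(𝓗)` IS a blow-up of `V(𝓗)` along the restricted centre — the scheme-theoretic «restriction
property» — for an effective Cartier divisor `𝓗` of generic order exactly `m` along a regular, nowhere-dense, irreducible
centre (e.g. a closed point of a regular ambient of positive dimension).  Everything is over the tree's vocabulary:
`IsBlowup` (GW Def. 13.90, universal property), Mathlib's `Scheme.IdealSheafData.subscheme`, `controlledTransform`,
`strictTransformIdeal`, `IsEffectiveCartier`.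

TREE-FIRST: the weight-ONE case (regular hypersurface of maximal contact) is the Literature theorem
`IsBlowup.isBlowup_subscheme_controlledTransform` (`HypersurfaceRestriction.lean`, BGMW 2011 §4 Rem. (3)); the weight-`m`
input «`τᶜ(𝓗, m)` is the strict transform ideal» is `IsBlowup.strictTransformIdeal_eq_controlledTransform`
(`CartierDivisorControlledTransform.lean`, Kollár 2007, 3.30.2).  Here:

* §1 `isEffectiveCartier_comap_subschemeι_of_colon_le` — an effective Cartier divisor `E` restricts to an effective
  Cartier divisor on `V(T)` as soon as `(T : E) ⊆ T` (its local equation is a nonzerodivisor modulo `T`);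
* §2 `colon_controlledTransform_eq_controlledTransform_succ` — `(τᶜ(𝓗, m) : 𝓘_E) = τᶜ(𝓗, m+1)`, hence
  `colon_controlledTransform_le_of_strictTransformIdeal_eq`: if the strict transform ideal equals `τᶜ(𝓗, m)` then
  `τᶜ(𝓗, m)` is `𝓘_E`-colon-stable;
* §3 `exists_hom_subscheme_controlledTransform_weight` — the morphism `V(τᶜ(𝓗, m)) ⟶ V(𝓗)` over `π` exists;
  **`isBlowup_subscheme_controlledTransform_of_isEffectiveCartier`** — for ANY weight `m` with `𝓗 ⊆ C^m`: if `𝓘_E`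
  restricts to an effective Cartier divisor on `V(τᶜ(𝓗, m))` then every morphism `V(τᶜ(𝓗, m)) ⟶ V(𝓗)` over `π` is a
  blow-up of `V(𝓗)` along `C|_{V(𝓗)}` (universal property of `π`; `π^*𝓗 = 𝓘_E^m · τᶜ(𝓗, m)` and cancellation of the
  Cartier factor `g^*𝓘_E^m`);
* §4 **`isBlowup_subscheme_controlledTransform_of_idealOrder_eq`** — (M-c): `X` locally Noetherian regular, `π` a
  blow-up along `C` with `V(C)` regular, irreducible with generic point `η` and nowhere dense, `𝓗` an effective Cartier
  divisor with `ord_η 𝓗 = m`: `V(τᶜ(𝓗, m)) ⟶ V(𝓗)` is the blow-up of the hypersurface along `C|_{V(𝓗)}`.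

[cite: BierstoneGrigorievMilmanWlodarczyk2011, §4 Remark (3) and Lemma 3.6.4 (6) (the restriction property)]
[cite: Kollar2007, 3.30.2 (birational transform of a divisor = τ^*D − mE)]
[cite: GortzWedhorn2020, Def. 13.90 and Prop. 13.96 (2) (blow-ups by the universal property; strict transforms)]
OURS · counted 0 · nothing here proves `ModelRow`, E2(3,3), `NoIsolatedTrap 3 3`, or resolution of singularities in
dimension `≥ 4` / characteristic `p`.  Supports stmt-ResolutionOfSingularities-16155 (helper).
bears_on: LADDER-RESOLUTION:D157-DOOR2 (res-dim4-pi · E2 dictionary · (M-c)).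
-/

set_option linter.dupNamespace false -- mandated namespace of this single-conjunct summit

noncomputable section

open CategoryTheory CategoryTheory.Limits AlgebraicGeometry TopologicalSpace IsLocalRing
open Literature.AlgebraicGeometry.Resolution

namespace Summit.ResolutionOfSingularities.ResolutionOfSingularities.Theorems.PIDim4

namespace StrictTransformBlowup

universe u

/-! ## 1. An effective Cartier divisor restricts to one on `V(T)` when `T` is colon-stable -/

/-- **Restriction of an effective Cartier divisor to a closed subscheme.**  On a locally Noetherian scheme, if `E` is an
effective Cartier divisor and the ideal sheaf `T` is `E`-colon-stable, `(T : E) ⊆ T` (the local equation of `E` is a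
nonzerodivisor modulo `T`), then `E` restricts to an effective Cartier divisor on `V(T)`. [folklore] -/
theorem isEffectiveCartier_comap_subschemeι_of_colon_le {X' : Scheme.{u}} [IsLocallyNoetherian X']
    {E T : X'.IdealSheafData} (hE : IsEffectiveCartier E) (hcol : colon T E ≤ T) :
    IsEffectiveCartier (E.comap T.subschemeι) := by
  intro s
  obtain ⟨V, hxV, g₀, hg₀, hEV⟩ := hE (T.subschemeι s)
  let U' : T.subscheme.affineOpens := ⟨T.subschemeι ⁻¹ᵁ (V : X'.Opens), V.2.preimage _⟩
  have hsU' : s ∈ (U' : T.subscheme.Opens) := hxV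
  refine ⟨U', hsU', T.subschemeι.app V g₀, ?_, ?_⟩
  · -- nonzerodivisor modulo `T(V)`
    rw [mem_nonZeroDivisors_iff_right]
    intro y hy
    obtain ⟨s₁, rfl⟩ := T.subschemeι_app_surjective V y
    have hmem : s₁ * g₀ ∈ RingHom.ker (T.subschemeι.app V).hom := by
      rw [RingHom.mem_ker, map_mul]
      exact hy
    rw [Scheme.IdealSheafData.ker_subschemeι_app] at hmem
    -- `s₁ · E(V) ⊆ T(V)`, so `s₁ ∈ (T : E)(V) ⊆ T(V)`
    have hs₁ : s₁ ∈ (colon T E).ideal V := by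
      rw [ideal_colon, hEV, Submodule.mem_colon]
      intro g hg
      obtain ⟨a, rfl⟩ := Ideal.mem_span_singleton'.mp hg
      rw [smul_eq_mul, show s₁ * (a * g₀) = a * (s₁ * g₀) by ring]
      exact Ideal.mul_mem_left _ _ hmem
    have hs₁' : s₁ ∈ T.ideal V := hcol V hs₁
    rw [← Scheme.IdealSheafData.ker_subschemeι_app T V] at hs₁'
    exact hs₁'
  · rw [ideal_comap_of_le T.subschemeι E V U' le_rfl, hEV, Ideal.map_span, Set.image_singleton,
      ← Scheme.Hom.app_eq_appLE]

/-! ## 2. Colon-stability of the controlled transform with the generic weight -/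

section Colon

variable {X X' : Scheme.{u}} (π : X' ⟶ X) (C H : X.IdealSheafData)

/-- `(τᶜ(𝓗, m) : 𝓘_E) = τᶜ(𝓗, m + 1)`. [folklore] -/
theorem colon_controlledTransform_eq_controlledTransform_succ (m : ℕ) :
    colon (controlledTransform π C H m) (C.comap π) = controlledTransform π C H (m + 1) := by
  rw [controlledTransform, controlledTransform, pow_succ, colon_mul_eq_colon_colon]

/-- **Colon-stability**: if the strict transform ideal `⋃ₙ (π^*𝓗 : 𝓘_Eⁿ)` equals `τᶜ(𝓗, m)`, then
`(τᶜ(𝓗, m) : 𝓘_E) ⊆ τᶜ(𝓗, m)`. [folklore] -/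
theorem colon_controlledTransform_le_of_strictTransformIdeal_eq {m : ℕ}
    (h : strictTransformIdeal π C H = controlledTransform π C H m) :
    colon (controlledTransform π C H m) (C.comap π) ≤ controlledTransform π C H m := by
  rw [colon_controlledTransform_eq_controlledTransform_succ, ← h]
  exact controlledTransform_le_strictTransformIdeal π C H (m + 1)

end Colon

/-! ## 3. The restriction property for an arbitrary weight, given the Cartier restriction -/

section Restriction

variable {X X' : Scheme.{u}} {π : X' ⟶ X} {C H : X.IdealSheafData}

/-- **The morphism `V(τᶜ(𝓗, m)) ⟶ V(𝓗)` induced by the blow-up exists** (`π^*𝓗 ⊆ τᶜ(𝓗, m)`), every weight `m`.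
[cite: BierstoneGrigorievMilmanWlodarczyk2011, Lemma 3.6.4 (6)] -/
theorem exists_hom_subscheme_controlledTransform_weight (π : X' ⟶ X) (C H : X.IdealSheafData) (m : ℕ) :
    ∃ πS : (controlledTransform π C H m).subscheme ⟶ H.subscheme,
      πS ≫ H.subschemeι = (controlledTransform π C H m).subschemeι ≫ π := by
  have hker : H.subschemeι.ker ≤ ((controlledTransform π C H m).subschemeι ≫ π).ker := by
    rw [Scheme.IdealSheafData.ker_subschemeι, le_ker_iff_comap_eq_bot,
      Scheme.IdealSheafData.comap_comp]
    refine le_bot_iff.mp ?_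
    calc (H.comap π).comap (controlledTransform π C H m).subschemeι
        ≤ (controlledTransform π C H m).comap (controlledTransform π C H m).subschemeι :=
          Scheme.IdealSheafData.comap_mono (f := (controlledTransform π C H m).subschemeι)
            (comap_le_controlledTransform π C H m)
      _ = ⊥ := comap_subschemeι_self _
  exact ⟨IsClosedImmersion.lift _ _ hker, IsClosedImmersion.lift_fac _ _ hker⟩

/-- **The restriction property, any weight** (universal-property argument of BGMW §4 Rem. (3)): let `X` be locally
Noetherian, `π : X' ⟶ X` a blow-up along `C`, `𝓗 ⊆ C^m`, and suppose the exceptional divisor `𝓘_E = C·𝒪_{X'}`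
restricts to an effective Cartier divisor on `V(τᶜ(𝓗, m))`.  Then every morphism `πS : V(τᶜ(𝓗, m)) ⟶ V(𝓗)` over
`π` is a blow-up of `V(𝓗)` along `C|_{V(𝓗)}`.  (A morphism `f : W ⟶ V(𝓗)` making `C` Cartier lifts to `g : W ⟶ X'`;
`g` lands in `V(τᶜ(𝓗, m))` because `π^*𝓗 = 𝓘_E^m · τᶜ(𝓗, m)`, `g^*π^*𝓗 = 0` and `g^*𝓘_E^m` is Cartier.)
[cite: BierstoneGrigorievMilmanWlodarczyk2011, §4 Remark (3)] [cite: GortzWedhorn2020, Def. 13.90] -/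
theorem isBlowup_subscheme_controlledTransform_of_isEffectiveCartier [IsLocallyNoetherian X]
    (hπ : IsBlowup π C) {m : ℕ} (hHC : H ≤ C ^ m)
    (hE : IsEffectiveCartier ((C.comap π).comap (controlledTransform π C H m).subschemeι))
    (πS : (controlledTransform π C H m).subscheme ⟶ H.subscheme)
    (hπS : πS ≫ H.subschemeι = (controlledTransform π C H m).subschemeι ≫ π) :
    IsBlowup πS (C.comap H.subschemeι) := by
  haveI : IsLocallyNoetherian X' := hπ.isLocallyNoetherian
  constructor
  · -- the exceptional locus on `V(τᶜ(𝓗, m))` is effective Cartier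
    rw [← Scheme.IdealSheafData.comap_comp, hπS, Scheme.IdealSheafData.comap_comp]
    exact hE
  · -- universality
    intro W f hf
    have hf' : IsEffectiveCartier (C.comap (f ≫ H.subschemeι)) := by
      rwa [Scheme.IdealSheafData.comap_comp]
    obtain ⟨g, hg, hgu⟩ := hπ.universal (f ≫ H.subschemeι) hf'
    -- `g` lands in `V(τᶜ(𝓗, m))`
    have hDg : IsEffectiveCartier ((C.comap π).comap g) := by
      rwa [← Scheme.IdealSheafData.comap_comp, hg]
    have hprod : (C.comap π).comap g ^ m * (controlledTransform π C H m).comap g = ⊥ := by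
      rw [← comap_pow, ← comap_mul]
      have h := pow_mul_controlledTransform_eq π C (I := H) (μ := m) hπ.isEffectiveCartier
        (comap_le_comap_pow_of_le_pow hHC π)
      rw [h, ← Scheme.IdealSheafData.comap_comp, hg, Scheme.IdealSheafData.comap_comp,
        comap_subschemeι_self, comap_bot]
    have hle : (controlledTransform π C H m).subschemeι.ker ≤ g.ker := by
      rw [Scheme.IdealSheafData.ker_subschemeι, le_ker_iff_comap_eq_bot]
      exact (hDg.pow m).eq_bot_of_mul_eq_bot hprod
    refine ⟨IsClosedImmersion.lift (controlledTransform π C H m).subschemeι g hle, ?_, ?_⟩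
    · show IsClosedImmersion.lift (controlledTransform π C H m).subschemeι g hle ≫ πS = f
      rw [← cancel_mono H.subschemeι, Category.assoc, hπS, IsClosedImmersion.lift_fac_assoc, hg]
    · intro g' hg'
      change g' ≫ πS = f at hg'
      rw [← cancel_mono (controlledTransform π C H m).subschemeι, IsClosedImmersion.lift_fac]
      apply hgu
      show (g' ≫ (controlledTransform π C H m).subschemeι) ≫ π = f ≫ H.subschemeι
      rw [Category.assoc, ← hπS, ← Category.assoc, hg']

end Restriction

/-! ## 4. (M-c): an effective Cartier divisor of generic order `m` along a regular centre -/

section OrderM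

variable {X X' : Scheme.{u}} {π : X' ⟶ X} {C 𝓗 : X.IdealSheafData} {η : X} {m : ℕ}

/-- **(M-c) The restriction property for a hypersurface of generic order `m`.**  Let `X` be locally Noetherian and
REGULAR, `π : X' ⟶ X` a blow-up along `C` with `V(C)` regular, irreducible with generic point `η`, nowhere dense, and
`𝓗` an effective Cartier divisor with `ord_η 𝓗 = m`.  Then every morphism `V(τᶜ(𝓗, m)) ⟶ V(𝓗)` over `π` — the
subscheme cut out by the controlled transform with the ORDER as weight, i.e. by the strict transform ideal
(`IsBlowup.strictTransformIdeal_eq_controlledTransform`) — is a blow-up of the hypersurface `V(𝓗)` along `C|_{V(𝓗)}`.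
For a closed point centre of a regular ambient of positive dimension this is «`Bl_x Z ⊇ V(τᶜ((g), ord_x g)) = Bl_x V(g)`».
[cite: Kollar2007, 3.30.2] [cite: BierstoneGrigorievMilmanWlodarczyk2011, §4 Remark (3)] -/
theorem isBlowup_subscheme_controlledTransform_of_idealOrder_eq [IsLocallyNoetherian X]
    (hX : Scheme.IsRegular X) (hπ : IsBlowup π C) (hC : Scheme.IsRegular C.subscheme)
    (hη : IsGenericPoint η (C.support : Set X)) (hint : interior (C.support : Set X) = ∅)
    (h𝓗 : IsEffectiveCartier 𝓗) (hm : idealOrder 𝓗 η = m)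
    (πS : (controlledTransform π C 𝓗 m).subscheme ⟶ 𝓗.subscheme)
    (hπS : πS ≫ 𝓗.subschemeι = (controlledTransform π C 𝓗 m).subschemeι ≫ π) :
    IsBlowup πS (C.comap 𝓗.subschemeι) := by
  haveI : IsLocallyNoetherian X' := hπ.isLocallyNoetherian
  have hstrict := hπ.strictTransformIdeal_eq_controlledTransform hX hC hη hint hm h𝓗
  exact isBlowup_subscheme_controlledTransform_of_isEffectiveCartier hπ
    (le_pow_of_idealOrder_genericPoint_eq hX hC hη hm)
    (isEffectiveCartier_comap_subschemeι_of_colon_le hπ.isEffectiveCartier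
      (colon_controlledTransform_le_of_strictTransformIdeal_eq π C 𝓗 hstrict)) πS hπS

/-- **(M-c), existence form**: under the same hypotheses there IS a morphism `V(τᶜ(𝓗, m)) ⟶ V(𝓗)` over `π`, and it
is a blow-up of `V(𝓗)` along `C|_{V(𝓗)}`. [cite: Kollar2007, 3.30.2] -/
theorem exists_isBlowup_subscheme_controlledTransform_of_idealOrder_eq [IsLocallyNoetherian X]
    (hX : Scheme.IsRegular X) (hπ : IsBlowup π C) (hC : Scheme.IsRegular C.subscheme)
    (hη : IsGenericPoint η (C.support : Set X)) (hint : interior (C.support : Set X) = ∅)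
    (h𝓗 : IsEffectiveCartier 𝓗) (hm : idealOrder 𝓗 η = m) :
    ∃ πS : (controlledTransform π C 𝓗 m).subscheme ⟶ 𝓗.subscheme,
      πS ≫ 𝓗.subschemeι = (controlledTransform π C 𝓗 m).subschemeι ≫ π ∧
        IsBlowup πS (C.comap 𝓗.subschemeι) := by
  obtain ⟨πS, hπS⟩ := exists_hom_subscheme_controlledTransform_weight π C 𝓗 m
  exact ⟨πS, hπS, isBlowup_subscheme_controlledTransform_of_idealOrder_eq hX hπ hC hη hint h𝓗 hm πS hπS⟩

end OrderM

end StrictTransformBlowup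

end Summit.ResolutionOfSingularities.ResolutionOfSingularities.Theorems.PIDim4

end
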